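import Mathlib
import Literature.NumberTheory.LFunctions.Zhang2022.SkeletonMeanValue
import Literature.NumberTheory.LFunctions.Zhang2022.Section14MeanSquareMajorant
import HarnessLib

/-!
# Zhang (2022) §7, (7.5): the elementary majorants behind the Cauchy chain — `|(κ∗a₁)(m)| ≤ Bτ₅(m)`,
# Hölder `(2,4,4)`, and the square of a truncated Dirichlet polynomial

Topic `Literature/NumberTheory/LFunctions/Zhang2022` (Landau–Siegel adjudication tree;
verdict-neutral). Y. Zhang, *Discrete mean estimates and the Landau–Siegel zero*,
arXiv:2211.02515v1 (2022) [Zhang2022LandauSiegel] — **an unrefereed manuscript under adjudication**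
— §7, proof of Proposition 7.1 «Initial steps», the passage around (7.5) (PDF p. 35, tex
L1900–L1910 of the arXiv source):

> Note that `(κ∗a₁)(m) = O(τ₅(m))`. The left side above is, by Cauchy's inequality,
> `≤ (Σ_{ψ∈Ψ} |Σ_{m<P²} (κ∗a₁)(m)ψ(m)m^{−s}|²)^{1/2} (Σ_{ψ∈Ψ} |A(𝐚₂;1−s,ψ̄)|⁴)^{1/4} (Σ_{ψ∈Ψ₂} 1)^{1/4}`
> `≪ (P² Σ_{m<P²} τ₅(m)²/m)^{1/2} (P² Σ_{m<P²} τ₂(m)²/m)^{1/4} (Σ_{ψ∈Ψ₂} 1)^{1/4}`.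
> This yields (7.5) by Proposition 2.1 and (2.9).

D-0069 campaign (cell `siegel-zhang`), discharge of the DAG nodes `Z22:§7.u019` and `Z22:(7.5)` as
typed by slice L2-t2 (`Section7aStatements`: `Step7u019kappa`, `Step7u019a`, `Step7u019b`,
`DedEq75`, `Eq75`). This first file carries the ELEMENTARY inputs, all proved here (0 new facts):

* `norm_kappa_le_tau_four`, `norm_conv_kappa_le` — `|κ(n)| ≤ τ₄(n)` for Zhang's
  `κ = n^{−β₁} ∗ n^{−β₂} ∗ n^{−β₃} ∗ μ` (purely imaginary shifts, tree `MeanSquareMajorant.kappa`),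
  hence `|(κ∗a)(m)| ≤ Bτ₅(m)` for `|a| ≤ B` (the tree's `MeanSquareMajorant.tau`,
  `norm_seqConv_le_tau` of `Section14MeanSquareMajorant`);
* `sum_mul_le_holder` — `Σ_S uv ≤ (Σ_T u²)^{1/2}(Σ_T v⁴)^{1/4}(#S)^{1/4}` for `S ⊆ T`, `u, v ≥ 0`;
* `sq_dirPoly_eq` — `(Σ_{n<N} a(n)θ(n)n^{−w})² = Σ_{1≤k≤K} (a′⋆a′)(k)θ(k)k^{−w}` for `θ` completely
  multiplicative with `θ(0) = 0`, `a′ = a·1_{<N}`, `(N−1)² ≤ K` (used for `A(𝐚₂;1−s,ψ̄)²`, whose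
  length `< P²T⁻⁴` is within the large sieve's `P²`);
* bookkeeping: `one_lt_bigT`, `Ico_subset_Icc_floor`, `cast_ceil_sub_one_le`, `Ico_one_ceil_eq`,
  `exists_nat_le_ell`.

The large-sieve factors and the exponent count are in `Section7Eq75LargeSieve`; the node theorems
in `Section7Eq75Discharge`. WHAT THIS FILE IS NOT: any claim about the manuscript's Theorems 1–2
or about Landau–Siegel zeros.

## References

* Y. Zhang, arXiv:2211.02515v1 (2022), §7 (7.5) p. 35. [cite: Zhang2022LandauSiegel, §7 (7.5) p.35]
-/

noncomputable section

open Complex Real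

namespace Literature.NumberTheory.LFunctions.Zhang2022.Section7Eq75

open Finset MeanSquareMajorant ArithmeticFunction

/-! ### `|κ(n)| ≤ τ₄(n)` and `|(κ ∗ a)(m)| ≤ B τ₅(m)` -/

/-- Divisor-type majorants multiply under the Dirichlet product of arithmetic functions:
`|f| ≤ C₁τ_{j₁}`, `|g| ≤ C₂τ_{j₂}` off `0` ⇒ `|(f ∗ g)(n)| ≤ C₁C₂τ_{j₁+j₂}(n)`. [folklore] -/
private theorem norm_mul_apply_le_tau {f g : ArithmeticFunction ℂ} {C₁ C₂ : ℝ} {j₁ j₂ : ℕ} (hC₁ : 0 ≤ C₁)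
    (hf : ∀ n, n ≠ 0 → ‖f n‖ ≤ C₁ * tau j₁ n) (hg : ∀ n, n ≠ 0 → ‖g n‖ ≤ C₂ * tau j₂ n) (n : ℕ) :
    ‖(f * g) n‖ ≤ C₁ * C₂ * tau (j₁ + j₂) n := by
  rw [ArithmeticFunction.mul_apply]
  exact norm_seqConv_le_tau hC₁ hf hg n

/-- `|n^{-ib}| ≤ τ₁(n)` for `n ≥ 1` (both sides are `1`). [folklore] -/
private theorem norm_powI_le_tau_one (b : ℝ) (n : ℕ) (hn : n ≠ 0) : ‖powI b n‖ ≤ 1 * tau 1 n := by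
  rw [norm_powI_of_pos b (Nat.pos_of_ne_zero hn), tau_one_apply hn, mul_one]

/-- `|μ(n)| ≤ τ₁(n)` for `n ≥ 1`. [folklore] -/
private theorem norm_moebius_le_tau_one (n : ℕ) (hn : n ≠ 0) :
    ‖(ArithmeticFunction.moebius : ArithmeticFunction ℂ) n‖ ≤ 1 * tau 1 n := by
  rw [tau_one_apply hn, mul_one]
  exact norm_moebius_complex_le_one n

/-- **`|κ(n)| ≤ τ₄(n)`** for Zhang's `κ = n^{-β₁} ∗ n^{-β₂} ∗ n^{-β₃} ∗ μ` (purely imaginary shifts):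
three unimodular factors and `|μ| ≤ 1`. [cite: Zhang2022LandauSiegel, §7 p.35, tex L1903] -/
theorem norm_kappa_le_tau_four (b₁ b₂ b₃ : ℝ) (n : ℕ) : ‖kappa b₁ b₂ b₃ n‖ ≤ tau 4 n := by
  have h2 : ∀ n, n ≠ 0 → ‖(powI b₁ * powI b₂) n‖ ≤ 1 * 1 * tau (1 + 1) n := fun n _ =>
    norm_mul_apply_le_tau zero_le_one (norm_powI_le_tau_one b₁) (norm_powI_le_tau_one b₂) n
  have h3 : ∀ n, n ≠ 0 → ‖(powI b₁ * powI b₂ * powI b₃) n‖ ≤ 1 * 1 * 1 * tau (1 + 1 + 1) n :=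
    fun n _ => norm_mul_apply_le_tau (by norm_num) h2 (norm_powI_le_tau_one b₃) n
  have h4 := norm_mul_apply_le_tau (by norm_num) h3 norm_moebius_le_tau_one n
  simpa [kappa] using h4

/-- **`(κ ∗ a)(m) = O(τ₅(m))`** ("Note that `(κ∗a₁)(m) = O(τ₅(m))`", p. 35): if `|a(n)| ≤ B` for
all `n` then `|(κ ∗ a)(m)| ≤ B τ₅(m)`. [cite: Zhang2022LandauSiegel, §7 p.35, tex L1903] -/
theorem norm_conv_kappa_le (b₁ b₂ b₃ : ℝ) {a : ℕ → ℂ} {B : ℝ} (ha : ∀ n, ‖a n‖ ≤ B) (m : ℕ) :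
    ‖conv (kappa b₁ b₂ b₃) a m‖ ≤ B * tau 5 m := by
  have hκ : ∀ n, n ≠ 0 → ‖kappa b₁ b₂ b₃ n‖ ≤ 1 * tau 4 n := fun n _ => by
    rw [one_mul]; exact norm_kappa_le_tau_four b₁ b₂ b₃ n
  have ha' : ∀ n, n ≠ 0 → ‖a n‖ ≤ B * tau 1 n := fun n hn => by
    rw [tau_one_apply hn, mul_one]; exact ha n
  have h := norm_seqConv_le_tau zero_le_one hκ ha' m
  rw [one_mul] at h
  exact h

/-! ### Hölder's inequality with exponents `(2, 4, 4)` -/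

/-- **Hölder with exponents `(2, 4, 4)`** on a finite set `S`, the first two factors enlarged to a
superset `T`: for `u, v ≥ 0`,
`Σ_S u v ≤ (Σ_T u²)^{1/2} (Σ_T v⁴)^{1/4} (#S)^{1/4}` (Cauchy's inequality twice) — the shape of
"The left side above is, by Cauchy's inequality, ≤ …" in (7.5).
[cite: Zhang2022LandauSiegel, §7 p.35, tex L1904] -/
theorem sum_mul_le_holder {ι : Type*} (S T : Finset ι) (hST : S ⊆ T) (u v : ι → ℝ)
    (hu : ∀ i, 0 ≤ u i) (hv : ∀ i, 0 ≤ v i) :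
    ∑ i ∈ S, u i * v i ≤
      (∑ i ∈ T, u i ^ 2) ^ (1 / 2 : ℝ) * (∑ i ∈ T, v i ^ 4) ^ (1 / 4 : ℝ) *
        (S.card : ℝ) ^ (1 / 4 : ℝ) := by
  set X := ∑ i ∈ S, u i * v i with hXdef
  set U := ∑ i ∈ T, u i ^ 2 with hUdef
  set V := ∑ i ∈ T, v i ^ 4 with hVdef
  have hX : 0 ≤ X := Finset.sum_nonneg fun i _ => mul_nonneg (hu i) (hv i)
  have hU : 0 ≤ U := Finset.sum_nonneg fun i _ => sq_nonneg _
  have hV : 0 ≤ V := Finset.sum_nonneg fun i _ => by positivity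
  have h1 : X ^ 2 ≤ (∑ i ∈ S, u i ^ 2) * (∑ i ∈ S, v i ^ 2) :=
    Finset.sum_mul_sq_le_sq_mul_sq S u v
  have h2 : (∑ i ∈ S, v i ^ 2) ^ 2 ≤ (∑ i ∈ S, v i ^ 4) * S.card := by
    have h := Finset.sum_mul_sq_le_sq_mul_sq S (fun i => v i ^ 2) (fun _ => (1 : ℝ))
    simp only [mul_one, one_pow, Finset.sum_const, nsmul_eq_mul] at h
    calc (∑ i ∈ S, v i ^ 2) ^ 2 ≤ (∑ i ∈ S, (v i ^ 2) ^ 2) * (S.card : ℝ) := h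
      _ = (∑ i ∈ S, v i ^ 4) * S.card := by
          congr 1; exact Finset.sum_congr rfl fun i _ => by ring
  have hA : ∑ i ∈ S, u i ^ 2 ≤ U :=
    Finset.sum_le_sum_of_subset_of_nonneg hST fun i _ _ => sq_nonneg _
  have hB : ∑ i ∈ S, v i ^ 4 ≤ V :=
    Finset.sum_le_sum_of_subset_of_nonneg hST fun i _ _ => by positivity
  have hSu : 0 ≤ ∑ i ∈ S, u i ^ 2 := Finset.sum_nonneg fun i _ => sq_nonneg _
  have h4 : X ^ 4 ≤ U ^ 2 * (V * S.card) := by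
    calc X ^ 4 = (X ^ 2) ^ 2 := by ring
      _ ≤ ((∑ i ∈ S, u i ^ 2) * (∑ i ∈ S, v i ^ 2)) ^ 2 := pow_le_pow_left₀ (sq_nonneg _) h1 2
      _ = (∑ i ∈ S, u i ^ 2) ^ 2 * (∑ i ∈ S, v i ^ 2) ^ 2 := by ring
      _ ≤ U ^ 2 * ((∑ i ∈ S, v i ^ 4) * S.card) :=
          mul_le_mul (pow_le_pow_left₀ hSu hA 2) h2 (sq_nonneg _) (by positivity)
      _ ≤ U ^ 2 * (V * S.card) := by gcongr
  have h14 : (1 / 4 : ℝ) = ((4 : ℕ) : ℝ)⁻¹ := by norm_num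
  have hroot : X ≤ (U ^ 2 * (V * S.card)) ^ (1 / 4 : ℝ) := by
    rw [h14]
    calc X = (X ^ 4) ^ ((4 : ℕ) : ℝ)⁻¹ := (Real.pow_rpow_inv_natCast hX four_ne_zero).symm
      _ ≤ (U ^ 2 * (V * S.card)) ^ ((4 : ℕ) : ℝ)⁻¹ :=
          Real.rpow_le_rpow (by positivity) h4 (by positivity)
  have hsplit : (U ^ 2 * (V * S.card)) ^ (1 / 4 : ℝ) =
      U ^ (1 / 2 : ℝ) * V ^ (1 / 4 : ℝ) * (S.card : ℝ) ^ (1 / 4 : ℝ) := by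
    rw [Real.mul_rpow (by positivity) (by positivity), Real.mul_rpow hV (by positivity),
      ← mul_assoc]
    congr 2
    rw [← Real.rpow_natCast_mul hU]
    norm_num
  exact hroot.trans_eq hsplit

/-! ### The square of a truncated Dirichlet polynomial -/

/-- Truncation `a′ = a·1_{n<N}` of a sequence (in the manuscript `a(n) = 0` for `n ≥ PT⁻²`,
(7.2)): `|a′(n)| ≤ max B 0` when `|a(n)| ≤ B`. [cite: Zhang2022LandauSiegel, §7 (7.2) p.33] -/
theorem norm_truncSeq_le {N : ℕ} {a : ℕ → ℂ} {B : ℝ} (ha : ∀ n, ‖a n‖ ≤ B) (n : ℕ) :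
    ‖(fun n => if n < N then a n else 0) n‖ ≤ max B 0 := by
  simp only
  split_ifs
  · exact (ha n).trans (le_max_left _ _)
  · rw [norm_zero]; exact le_max_right _ _

/-- The self-convolution of a sequence truncated to `n < N` vanishes beyond `(N−1)²` (the length
of `A(𝐚₂;1−s,ψ̄)²` in (7.5) is `< P²T⁻⁴`). [cite: Zhang2022LandauSiegel, §7 p.35, tex L1904] -/
theorem seqConv_truncSeq_eq_zero {N : ℕ} (a : ℕ → ℂ) {k : ℕ} (hk : (N - 1) * (N - 1) < k) :
    seqConv (fun n => if n < N then a n else 0) (fun n => if n < N then a n else 0) k = 0 := by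
  unfold seqConv
  refine Finset.sum_eq_zero fun x hx => ?_
  have hx' := (Nat.mem_divisorsAntidiagonal.1 hx).1
  simp only
  split_ifs with h1 h2
  · exfalso
    have h1' : x.1 ≤ N - 1 := Nat.le_sub_one_of_lt h1
    have h2' : x.2 ≤ N - 1 := Nat.le_sub_one_of_lt h2
    have : k ≤ (N - 1) * (N - 1) := hx' ▸ Nat.mul_le_mul h1' h2'
    omega
  · simp
  · simp
  · simp

/-- **The square of a truncated Dirichlet polynomial with completely multiplicative twist**:
for `θ` completely multiplicative with `θ(0) = 0` and `(N−1)² ≤ K`,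
`(Σ_{n<N} a(n)θ(n)n^{−w})² = Σ_{1≤k≤K} (a′⋆a′)(k)θ(k)k^{−w}`, `a′ = a·1_{n<N}`
(in the manuscript: `A(𝐚₂;1−s,ψ̄)²`, `θ = ψ̄`, inside the fourth moment of (7.5)).
[cite: Zhang2022LandauSiegel, §7 p.35, tex L1904] -/
theorem sq_dirPoly_eq (N K : ℕ) (hK : (N - 1) * (N - 1) ≤ K) (a : ℕ → ℂ) (θ : ℕ → ℂ)
    (hθ0 : θ 0 = 0) (hθ : ∀ m n, θ (m * n) = θ m * θ n) (w : ℂ) :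
    (∑ n ∈ Finset.range N, a n * θ n * (n : ℂ) ^ (-w)) ^ 2 =
      ∑ k ∈ Finset.Icc 1 K, seqConv (fun n => if n < N then a n else 0)
        (fun n => if n < N then a n else 0) k * θ k * (k : ℂ) ^ (-w) := by
  classical
  set truncSeq : ℕ → ℂ := fun n => if n < N then a n else 0 with htr
  set F : ℕ × ℕ → ℂ := fun x =>
    truncSeq x.1 * truncSeq x.2 * (θ (x.1 * x.2) * ((x.1 * x.2 : ℕ) : ℂ) ^ (-w)) with hF
  -- the left side over `Ico 1 N`
  have hr : ∑ n ∈ Finset.range N, a n * θ n * (n : ℂ) ^ (-w) =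
      ∑ n ∈ Finset.Ico 1 N, truncSeq n * θ n * (n : ℂ) ^ (-w) := by
    rcases Nat.eq_zero_or_pos N with rfl | hN
    · simp
    · rw [Finset.range_eq_Ico, Finset.sum_eq_sum_Ico_succ_bot hN, hθ0, mul_zero, zero_mul,
        zero_add]
      refine Finset.sum_congr rfl fun n hn => ?_
      simp only [htr, if_pos (Finset.mem_Ico.1 hn).2]
  have hL : (∑ n ∈ Finset.range N, a n * θ n * (n : ℂ) ^ (-w)) ^ 2 =
      ∑ x ∈ Finset.Ico 1 N ×ˢ Finset.Ico 1 N, F x := by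
    rw [hr, sq, Finset.sum_mul_sum, Finset.sum_product]
    refine Finset.sum_congr rfl fun n _ => Finset.sum_congr rfl fun m _ => ?_
    simp only [hF, hθ, Nat.cast_mul, Complex.natCast_mul_natCast_cpow]
    ring
  -- the right side over the union of the antidiagonals
  have hdisj : (↑(Finset.Icc 1 K) : Set ℕ).PairwiseDisjoint Nat.divisorsAntidiagonal := by
    intro k₁ _ k₂ _ hne
    rw [Function.onFun, Finset.disjoint_left]
    intro x h₁ h₂
    exact hne ((Nat.mem_divisorsAntidiagonal.1 h₁).1.symm.trans (Nat.mem_divisorsAntidiagonal.1 h₂).1)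
  have hR : ∑ k ∈ Finset.Icc 1 K, seqConv truncSeq truncSeq k * θ k * (k : ℂ) ^ (-w) =
      ∑ x ∈ (Finset.Icc 1 K).biUnion Nat.divisorsAntidiagonal, F x := by
    rw [Finset.sum_biUnion hdisj]
    refine Finset.sum_congr rfl fun k _ => ?_
    rw [seqConv, Finset.sum_mul, Finset.sum_mul]
    refine Finset.sum_congr rfl fun x hx => ?_
    obtain ⟨hxk, -⟩ := Nat.mem_divisorsAntidiagonal.1 hx
    simp only [hF, hxk]
    ring
  -- the product sits inside the union, and `F` vanishes off the product
  have hsub : Finset.Ico 1 N ×ˢ Finset.Ico 1 N ⊆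
      (Finset.Icc 1 K).biUnion Nat.divisorsAntidiagonal := by
    intro x hx
    rw [Finset.mem_product, Finset.mem_Ico, Finset.mem_Ico] at hx
    rw [Finset.mem_biUnion]
    have hne : x.1 * x.2 ≠ 0 :=
      Nat.mul_ne_zero (Nat.one_le_iff_ne_zero.1 hx.1.1) (Nat.one_le_iff_ne_zero.1 hx.2.1)
    refine ⟨x.1 * x.2, Finset.mem_Icc.2 ⟨Nat.one_le_iff_ne_zero.2 hne, ?_⟩,
      Nat.mem_divisorsAntidiagonal.2 ⟨rfl, hne⟩⟩
    exact le_trans (Nat.mul_le_mul (Nat.le_sub_one_of_lt hx.1.2) (Nat.le_sub_one_of_lt hx.2.2)) hK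
  have hzero : ∀ x ∈ (Finset.Icc 1 K).biUnion Nat.divisorsAntidiagonal,
      x ∉ Finset.Ico 1 N ×ˢ Finset.Ico 1 N → F x = 0 := by
    intro x hx hx'
    rw [Finset.mem_biUnion] at hx
    obtain ⟨k, _, hk⟩ := hx
    have hk' := Nat.mem_divisorsAntidiagonal.1 hk
    have h1 : x.1 ≠ 0 := fun h => hk'.2 (by rw [← hk'.1, h, zero_mul])
    have h2 : x.2 ≠ 0 := fun h => hk'.2 (by rw [← hk'.1, h, mul_zero])
    rw [Finset.mem_product, Finset.mem_Ico, Finset.mem_Ico, not_and_or] at hx'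
    rw [hF]
    rcases hx' with h | h
    · have : ¬ x.1 < N := fun h' => h ⟨Nat.one_le_iff_ne_zero.2 h1, h'⟩
      simp [htr, this]
    · have : ¬ x.2 < N := fun h' => h ⟨Nat.one_le_iff_ne_zero.2 h2, h'⟩
      simp [htr, this]
  rw [hL, hR]
  exact Finset.sum_subset hsub hzero

/-! ### Bookkeeping on the manuscript's parameters -/

/-- `T > 1` once `D ≥ 2` (`T = exp 𝓛^{1.1}`, `𝓛 = log D > 0`). [cite: Zhang2022LandauSiegel, §6 p.30] -/
theorem one_lt_bigT {D : ℕ} (hD : 2 ≤ D) : 1 < Skeleton.bigT D := by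
  have hL : 0 < Skeleton.ell D := by
    have : (2 : ℝ) ≤ D := by exact_mod_cast hD
    exact Real.log_pos (by linarith)
  exact Real.one_lt_exp_iff.2 (Real.rpow_pos_of_pos hL _)

/-- `{1 ≤ m < ⌈y⌉} ⊆ {1 ≤ m ≤ ⌊y⌋}` (the manuscript's `m < P²` of (7.5) inside the `n ≤ P²` of
Lemma 3.3 (ii)). [cite: Zhang2022LandauSiegel, §7 (7.5) p.35; §3 Lemma 3.3 p.14] -/
theorem Ico_subset_Icc_floor (y : ℝ) : Finset.Ico 1 ⌈y⌉₊ ⊆ Finset.Icc 1 ⌊y⌋₊ := fun m hm => by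
  rw [Finset.mem_Ico] at hm
  rw [Finset.mem_Icc]
  exact ⟨hm.1, Nat.le_floor (Nat.lt_ceil.1 hm.2).le⟩

/-- A member of `{1 ≤ m ≤ ⌊y⌋}` outside `{1 ≤ m < ⌈y⌉}` is `≥ y` (range bookkeeping `m < P²` of
(7.5)). [cite: Zhang2022LandauSiegel, §7 (7.5) p.35] -/
theorem not_lt_of_mem_sdiff {y : ℝ} {m : ℕ} (hm : m ∈ Finset.Icc 1 ⌊y⌋₊)
    (hm' : m ∉ Finset.Ico 1 ⌈y⌉₊) : ¬ (m : ℝ) < y := fun hlt =>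
  hm' (Finset.mem_Ico.2 ⟨(Finset.mem_Icc.1 hm).1, Nat.lt_ceil.2 hlt⟩)

/-- `⌈y⌉ − 1 ≤ y` for `y ≥ 0` (natural-number ceiling; the support bound `n < ⌈PT⁻²⌉` of (7.2)).
[cite: Zhang2022LandauSiegel, §7 (7.2) p.33] -/
theorem cast_ceil_sub_one_le {y : ℝ} (hy : 0 ≤ y) : ((⌈y⌉₊ - 1 : ℕ) : ℝ) ≤ y := by
  have h1 : (⌈y⌉₊ : ℝ) < y + 1 := Nat.ceil_lt_add_one hy
  rcases Nat.eq_zero_or_pos ⌈y⌉₊ with h | h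
  · rw [h]; simpa using hy
  · rw [Nat.cast_sub h, Nat.cast_one]; linarith

/-- `{1 ≤ m < ⌈y⌉} = {1 ≤ m ≤ ⌈y⌉ − 1}` (the range `m < P²` of (7.5) as a closed range).
[cite: Zhang2022LandauSiegel, §7 (7.5) p.35] -/
theorem Ico_one_ceil_eq (y : ℝ) : Finset.Ico 1 ⌈y⌉₊ = Finset.Icc 1 (⌈y⌉₊ - 1) := by
  ext m; simp only [Finset.mem_Ico, Finset.mem_Icc]; omega

/-- For every `M` there is `D₀` with `𝓛 = log D ≥ M` for `D ≥ D₀` ("`D` greater than a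
sufficiently large and effectively computable number"). [cite: Zhang2022LandauSiegel, §2 p.4] -/
theorem exists_nat_le_ell (M : ℝ) : ∃ D₀ : ℕ, ∀ D : ℕ, D₀ ≤ D → M ≤ Skeleton.ell D := by
  refine ⟨⌈Real.exp M⌉₊ + 1, fun D hD => ?_⟩
  have hD' : (⌈Real.exp M⌉₊ : ℝ) ≤ D := by exact_mod_cast (by omega : ⌈Real.exp M⌉₊ ≤ D)
  have h1 : Real.exp M ≤ D := le_trans (Nat.le_ceil _) hD'
  exact (Real.le_log_iff_exp_le (lt_of_lt_of_le (Real.exp_pos M) h1)).2 h1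

end Literature.NumberTheory.LFunctions.Zhang2022.Section7Eq75
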